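import Summits.Ventures.CertifiedManyBodySolver.Upper.UMPSPolarTensor
import HarnessLib

/-!
# uMPS dual certificates checked BY THE LEAN KERNEL, I: integer twins of `gram`, `Y_X`, `Φ`, `W`

HONEST FRAMING: first certified bounds; not a superconductivity verdict; every number certified or
labelled float.

Venture `Ventures/CertifiedManyBodySolver` (sr-mbsolver), VAR's `var-umps-cert-v1` files with
`ncell = 1` (`FORMAT-umps1.md`): a dyadic tensor `A^s = Aint s / 2^a` (`s : Fin 4`, `χ × χ` integers) and a
dyadic symmetric `Z = Zint / 2^b`. This file defines the INTEGER twins of the objects of METHOD-umps §1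
(`gram`, `bondImage`, `heisenberg`, `dualMatrix` of `UMPSPolarTensor.lean` / `UMPSDualBound.lean`) —
`gramZ`, `bondImageZ` (in the factored form `Σ_p (A_p₁A_p₂)ᵀ (Σ_p' X_pp' A_p'₁A_p'₂)` that keeps a kernel
evaluation at `O(q² χ³)`), `heisenbergZ`, `dualMatrixZ` — and proves how they read in `ℂ`:
`castC (dualMatrixZ Aint X Zint a b) = 2^(4a) • dualMatrix (Aint/2^a) (castC X) (Zint/2^b)` (`b ≤ 2a`).
Part II (`UMPSKernelCertificate.lean`) turns a kernel-evaluated Boolean on this integer data into the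
Venture's uMPS claim nodes. Nothing here is a new fact: 0 `sorry`, 0 new `def … : Prop`.
-/

noncomputable section

namespace Summit.Ventures.CertifiedManyBodySolver.Upper

open Matrix Finset Literature.MathematicalPhysics.QuantumLattice
open scoped ComplexOrder

/-! ### Integer matrices read in `ℂ` -/

section Cast

variable {m : Type*} [Fintype m] [DecidableEq m]

/-- An integer matrix read as a complex matrix (the ring homomorphism `M ↦ (M_{ij} : ℂ)`). -/
def castC : Matrix m m ℤ →+* Matrix m m ℂ := (Int.castRingHom ℂ).mapMatrix

/-- Entries of `castC M` are the integer entries read in `ℂ`. -/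
theorem castC_apply (M : Matrix m m ℤ) (i j : m) : castC M i j = (M i j : ℂ) := rfl

/-- `castC` commutes with transposition. -/
theorem castC_transpose (M : Matrix m m ℤ) : castC Mᵀ = (castC M)ᵀ := by
  ext i j; rfl

/-- The adjoint of an integer matrix read in `ℂ` is its transpose. -/
theorem conjTranspose_castC (M : Matrix m m ℤ) : (castC M)ᴴ = castC Mᵀ := by
  ext i j
  simp [castC_apply, conjTranspose_apply]

/-- `castC` takes integer scalar multiples to complex scalar multiples. -/
theorem castC_smul (c : ℤ) (M : Matrix m m ℤ) : castC (c • M) = (c : ℂ) • castC M := by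
  rw [map_zsmul, Int.cast_smul_eq_zsmul]

/-- A symmetric integer matrix is Hermitian in `ℂ`. -/
theorem castC_isHermitian {M : Matrix m m ℤ} (hM : ∀ i j, M i j = M j i) : (castC M).IsHermitian := by
  ext i j
  simp [castC_apply, conjTranspose_apply, hM j i]

/-- Row sums of an integer matrix read in `ℂ`: `Σ_j ‖(c • castC M) i j‖ = |c| Σ_j |M i j|`. -/
theorem sum_norm_smul_castC (c : ℝ) (M : Matrix m m ℤ) (i : m) :
    ∑ j, ‖((c : ℂ) • castC M) i j‖ = |c| * ∑ j, (|M i j| : ℝ) := by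
  rw [Finset.mul_sum]
  refine Finset.sum_congr rfl fun j _ => ?_
  rw [Matrix.smul_apply, castC_apply, smul_eq_mul, norm_mul, Complex.norm_real, Real.norm_eq_abs,
    Complex.norm_intCast]

end Cast

/-! ### The integer twins of `gram`, `bondImage`, `heisenberg`, `dualMatrix` -/

section Twins

variable {q D : ℕ}

/-- The dyadic unit `2^{-a}`, read in `ℂ`. -/
def dy (a : ℕ) : ℂ := ((((2 : ℝ) ^ a)⁻¹ : ℝ) : ℂ)

/-- `2^{-a}` is real: `star (dy a) = dy a`. -/
theorem star_dy (a : ℕ) : star (dy a) = dy a := by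
  rw [dy, Complex.star_def, Complex.conj_ofReal]

/-- `dy a = (2^a)⁻¹` in `ℂ`. -/
theorem dy_eq (a : ℕ) : dy a = ((2 : ℂ) ^ a)⁻¹ := by
  rw [dy]; push_cast; rfl

/-- An integer MPS tensor (`A^s = Aint s / 2^a`). -/
abbrev ZTensor (q D : ℕ) : Type := Fin q → Matrix (Fin D) (Fin D) ℤ

/-- The dyadic tensor `A^s = 2^{-a} · Aint s`. -/
def dyadicTensor (A : ZTensor q D) (a : ℕ) : MPSTensor q D := fun s => dy a • castC (A s)

/-- The dyadic matrix `Z = 2^{-b} · Zint`. -/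
def dyadicMatrix (Z : Matrix (Fin D) (Fin D) ℤ) (b : ℕ) : Matrix (Fin D) (Fin D) ℂ := dy b • castC Z

/-- Integer Gram matrix `Σ_s (Aint s)ᵀ Aint s` (`= 4^a · gram A`). -/
def gramZ (A : ZTensor q D) : Matrix (Fin D) (Fin D) ℤ := ∑ s, (A s)ᵀ * A s

/-- Integer Heisenberg map `Σ_s (Aint s)ᵀ B (Aint s)` (`= 4^a · Φ(B)`). -/
def heisenbergZ (A : ZTensor q D) (B : Matrix (Fin D) (Fin D) ℤ) : Matrix (Fin D) (Fin D) ℤ :=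
  ∑ s, (A s)ᵀ * (B * A s)

/-- Integer bond image, in the factored form `Σ_p (A_{p₁}A_{p₂})ᵀ (Σ_{p'} X_{pp'} A_{p'₁}A_{p'₂})`
(`= 16^a · Y_X`; the factoring is what keeps the kernel evaluation at `O(q² χ³)`). -/
def bondImageZ (A : ZTensor q D) (X : Matrix (Fin q × Fin q) (Fin q × Fin q) ℤ) :
    Matrix (Fin D) (Fin D) ℤ :=
  ∑ p : Fin q × Fin q, (A p.1 * A p.2)ᵀ * ∑ p' : Fin q × Fin q, X p p' • (A p'.1 * A p'.2)

/-- Integer dual matrix `2^{4a} · W(A; X, Z) = Y^ℤ + 2^{2a−b} Φ^ℤ(Zint) − 2^{4a−b} Zint` (`b ≤ 2a`). -/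
def dualMatrixZ (A : ZTensor q D) (X : Matrix (Fin q × Fin q) (Fin q × Fin q) ℤ)
    (Z : Matrix (Fin D) (Fin D) ℤ) (a b : ℕ) : Matrix (Fin D) (Fin D) ℤ :=
  bondImageZ A X + (2 ^ (2 * a - b) : ℤ) • heisenbergZ A Z - (2 ^ (4 * a - b) : ℤ) • Z

/-- The double-sum form of the integer bond image. -/
theorem bondImageZ_eq_sum_sum (A : ZTensor q D) (X : Matrix (Fin q × Fin q) (Fin q × Fin q) ℤ) :
    bondImageZ A X = ∑ p : Fin q × Fin q, ∑ p' : Fin q × Fin q,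
      X p p' • ((A p.1 * A p.2)ᵀ * (A p'.1 * A p'.2)) := by
  unfold bondImageZ
  refine Finset.sum_congr rfl fun p _ => ?_
  rw [Finset.mul_sum]
  refine Finset.sum_congr rfl fun p' _ => ?_
  rw [Matrix.mul_smul]

/-- `(Y^ℤ_X)ᵀ = Y^ℤ_{Xᵀ}`. -/
theorem bondImageZ_transpose (A : ZTensor q D) (X : Matrix (Fin q × Fin q) (Fin q × Fin q) ℤ) :
    (bondImageZ A X)ᵀ = bondImageZ A Xᵀ := by
  rw [bondImageZ_eq_sum_sum, bondImageZ_eq_sum_sum, Matrix.transpose_sum, Finset.sum_comm]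
  refine Finset.sum_congr rfl fun p _ => ?_
  rw [Matrix.transpose_sum]
  refine Finset.sum_congr rfl fun p' _ => ?_
  rw [transpose_smul, transpose_mul, transpose_transpose, transpose_apply]

/-- `Φ^ℤ(B)ᵀ = Φ^ℤ(Bᵀ)`. -/
theorem heisenbergZ_transpose (A : ZTensor q D) (B : Matrix (Fin D) (Fin D) ℤ) :
    (heisenbergZ A B)ᵀ = heisenbergZ A Bᵀ := by
  unfold heisenbergZ
  rw [Matrix.transpose_sum]
  refine Finset.sum_congr rfl fun s _ => ?_
  rw [transpose_mul, transpose_mul, transpose_transpose, Matrix.mul_assoc]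

/-- The integer dual matrix is symmetric when `X` and `Z` are. -/
theorem dualMatrixZ_symm (A : ZTensor q D) {X : Matrix (Fin q × Fin q) (Fin q × Fin q) ℤ}
    {Z : Matrix (Fin D) (Fin D) ℤ} (hX : ∀ p p', X p p' = X p' p) (hZ : ∀ i j, Z i j = Z j i)
    (a b : ℕ) (i j : Fin D) : dualMatrixZ A X Z a b i j = dualMatrixZ A X Z a b j i := by
  have hXt : Xᵀ = X := by ext p p'; exact hX p' p
  have hZt : Zᵀ = Z := by ext i j; exact hZ j i
  have h : (dualMatrixZ A X Z a b)ᵀ = dualMatrixZ A X Z a b := by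
    unfold dualMatrixZ
    rw [transpose_sub, transpose_add, transpose_smul, transpose_smul, bondImageZ_transpose,
      heisenbergZ_transpose, hXt, hZt]
  have := congrFun (congrFun h j) i
  rwa [transpose_apply] at this

/-! ### Reading the twins in `ℂ` -/

/-- `gram (Aint/2^a) = (dy a)² · castC (gramZ Aint)`. -/
theorem gram_dyadicTensor (A : ZTensor q D) (a : ℕ) :
    gram (dyadicTensor A a) = (dy a * dy a) • castC (gramZ A) := by
  unfold gram gramZ dyadicTensor
  rw [map_sum, Finset.smul_sum]
  refine Finset.sum_congr rfl fun s _ => ?_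
  rw [conjTranspose_smul, Matrix.smul_mul, Matrix.mul_smul, smul_smul, map_mul, conjTranspose_castC,
    castC_transpose, star_dy]

/-- The two-site products of the dyadic tensor. -/
theorem dyadicTensor_mul (A : ZTensor q D) (a : ℕ) (s s' : Fin q) :
    dyadicTensor A a s * dyadicTensor A a s' = (dy a * dy a) • castC (A s * A s') := by
  unfold dyadicTensor
  rw [Matrix.smul_mul, Matrix.mul_smul, smul_smul, map_mul]

/-- `Y_X(Aint/2^a) = (dy a)⁴ · castC (Y^ℤ_X)` for an integer two-site matrix `X`. -/
theorem bondImage_dyadicTensor (A : ZTensor q D) (a : ℕ) (X : Matrix (Fin q × Fin q) (Fin q × Fin q) ℤ) :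
    bondImage (dyadicTensor A a) (castC X) = (dy a * dy a * (dy a * dy a)) • castC (bondImageZ A X) := by
  rw [bondImageZ_eq_sum_sum, bondImage, map_sum, Finset.smul_sum]
  refine Finset.sum_congr rfl fun p _ => ?_
  rw [map_sum, Finset.smul_sum]
  refine Finset.sum_congr rfl fun p' _ => ?_
  rw [dyadicTensor_mul, dyadicTensor_mul, conjTranspose_smul, star_mul', star_dy, conjTranspose_castC,
    castC_apply, castC_smul, map_mul castC ((A p.1 * A p.2)ᵀ) (A p'.1 * A p'.2)]
  simp only [Matrix.smul_mul, Matrix.mul_smul, smul_smul]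
  congr 1
  ring

/-- `Φ_{Aint/2^a}(Zint/2^b) = (dy a)² (dy b) · castC (Φ^ℤ(Zint))`. -/
theorem heisenberg_dyadicTensor (A : ZTensor q D) (a b : ℕ) (Z : Matrix (Fin D) (Fin D) ℤ) :
    heisenberg (dyadicTensor A a) (dyadicMatrix Z b) = (dy a * dy a * dy b) • castC (heisenbergZ A Z) := by
  unfold heisenberg heisenbergZ dyadicTensor dyadicMatrix
  rw [map_sum, Finset.smul_sum]
  refine Finset.sum_congr rfl fun s _ => ?_
  simp only [conjTranspose_smul, Matrix.smul_mul, Matrix.mul_smul, smul_smul, star_dy, conjTranspose_castC,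
    castC_transpose, map_mul, Matrix.mul_assoc]
  congr 1
  ring

/-- `2^{4a} · (2^{-a})⁴ = 1`. -/
private theorem two_pow_mul_dy_pow (a : ℕ) : ((2 : ℂ) ^ (4 * a)) * (dy a * dy a * (dy a * dy a)) = 1 := by
  rw [dy_eq, show 4 * a = a * 4 by ring, pow_mul]
  have h : ((2 : ℂ) ^ a) ≠ 0 := pow_ne_zero _ two_ne_zero
  field_simp

/-- `2^{4a} · (2^{-a})² · 2^{-b} = 2^{2a-b}` (`b ≤ 2a`). -/
private theorem two_pow_mul_dy_sq_dy (a b : ℕ) (hb : b ≤ 2 * a) :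
    ((2 : ℂ) ^ (4 * a)) * (dy a * dy a * dy b) = ((2 ^ (2 * a - b) : ℤ) : ℂ) := by
  rw [dy_eq, dy_eq]
  have h : ((2 : ℂ) ^ a) ≠ 0 := pow_ne_zero _ two_ne_zero
  have hb' : ((2 : ℂ) ^ b) ≠ 0 := pow_ne_zero _ two_ne_zero
  have e : (2 : ℂ) ^ (4 * a) = 2 ^ (2 * a - b) * 2 ^ b * (2 ^ a * 2 ^ a) := by
    rw [← pow_add, ← pow_add, ← pow_add]; congr 1; omega
  rw [e]
  push_cast
  field_simp

/-- `2^{4a} · 2^{-b} = 2^{4a-b}` (`b ≤ 2a`). -/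
private theorem two_pow_mul_dy (a b : ℕ) (hb : b ≤ 2 * a) :
    ((2 : ℂ) ^ (4 * a)) * dy b = ((2 ^ (4 * a - b) : ℤ) : ℂ) := by
  rw [dy_eq]
  have hb' : ((2 : ℂ) ^ b) ≠ 0 := pow_ne_zero _ two_ne_zero
  have e : (2 : ℂ) ^ (4 * a) = 2 ^ (4 * a - b) * 2 ^ b := by rw [← pow_add]; congr 1; omega
  rw [e]
  push_cast
  field_simp

/-- **The integer dual matrix read in `ℂ` is `2^{4a} · W`**:
`castC (dualMatrixZ Aint X Zint a b) = 2^{4a} · W(Aint/2^a; X, Zint/2^b)` (`b ≤ 2a`). -/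
theorem castC_dualMatrixZ (A : ZTensor q D) (X : Matrix (Fin q × Fin q) (Fin q × Fin q) ℤ)
    (Z : Matrix (Fin D) (Fin D) ℤ) {a b : ℕ} (hb : b ≤ 2 * a) :
    castC (dualMatrixZ A X Z a b) =
      ((2 : ℂ) ^ (4 * a)) • dualMatrix (dyadicTensor A a) (castC X) (dyadicMatrix Z b) := by
  unfold dualMatrixZ dualMatrix
  rw [map_sub, map_add, castC_smul, castC_smul, bondImage_dyadicTensor, heisenberg_dyadicTensor,
    smul_sub, smul_add, smul_smul, smul_smul, dyadicMatrix, smul_smul, two_pow_mul_dy_pow, one_smul,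
    two_pow_mul_dy_sq_dy a b hb, two_pow_mul_dy a b hb]

end Twins

end Summit.Ventures.CertifiedManyBodySolver.Upper
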